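import Summits.Ventures.HodgeRepro2.T7SupportTwoTorusInvariant
import Summits.Ventures.HodgeRepro2.T7SupportWeightTorusContinuous

/-!
# The compact place: a regular point with non-vanishing coefficient in `U(2)` (support, seat p1)

The compact-place (`ι₁`) analogue of `T7SupportBergmanRegularPoint` (the rank-one places), for the DEFINITE
hermitian plane: `G = U(2) = Matrix.unitaryGroup (Fin 2) ℂ`, the form `h(x, y) = x₀ ȳ₀ + x₁ ȳ₁` (`d = ![1, 1]`), the
tori `K` (diagonal) and `h K h⁻¹`. The double-coset invariant of `T7SupportTwoTorusInvariant` is again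

  `κ(γ) = |(γ h)₀₀|²`   (`kappa_eq_normSq`),   now with `κ ≤ 1` and `κ = 1 ⟺ γ h ∈ K` (`kappa_eq_one_iff`),

the non-regular locus is `K h⁻¹`, and the real rotations `r(t) = [[cos t, sin t], [−sin t, cos t]] ∈ SU(2)` leave
`K` for `0 < t < π` (`kappa_rot_mul_inv : κ(r(t) h⁻¹) = cos² t < 1`). For ANY strongly continuous representation `τ`
of `U(2)` on an inner-product space (a continuous finite-dimensional representation) and any `x ≠ 0`, the coefficient
`⟪x, τ(γ h) x⟫` is continuous in `γ` with value `⟪x, x⟫ ≠ 0` at `γ = h⁻¹`, so it is non-zero at the regular points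
`r(t) h⁻¹` for small `t > 0`:

  `∃ γ₀, κ(γ₀) ≠ 1 ∧ coeff τ x x (γ₀ h) ≠ 0`   (`exists_regular_coeff_ne_zero`),

and, for `x` a weight vector of two tori `ρ_A, ρ_B : Circle →* U(2)` (matching characters), the two-torus orbital
integral of `T7SupportWeightTorusOrbital` at `γ₀` is non-zero (`exists_regular_torusOrbital_ne_zero`). This is the
«`a_{γ₀} ≠ 0` at a regular `γ₀`, compact place» half of (b′) in the model — by continuity alone, no identity theorem
(t7-crit-1's record (i), STATUS l. 15058); the identification of the model with `U(W_A)(F_{ι₁})` and its tori stays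
with the line.

Explicit model only; nothing about the adelic group or any period.
Blind lane: Mathlib + the HodgeRepro2 prefix only; no sorry; axioms ⊆ {propext, Classical.choice, Quot.sound}.
-/

namespace Summit.Ventures.HodgeRepro2.T7SupportCompactRegularPoint

open Matrix Filter Topology MeasureTheory
open scoped InnerProductSpace
open T7SupportTwoTorusInvariant T7SupportWeightTorusOrbital T7SupportWeightTorusContinuous

/-- the compact unitary group `U(2)` -/
abbrev U2 := Matrix.unitaryGroup (Fin 2) ℂ

/-- the matrix of `g ∈ U(2)` -/
abbrev matU (g : U2) : Matrix (Fin 2) (Fin 2) ℂ := (g : Matrix (Fin 2) (Fin 2) ℂ)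

/-- the definite signature `(1, 1)` -/
def dd2 : Fin 2 → ℂ := ![1, 1]

/-- the column relations of `gᴴ g = 1` -/
theorem entries (g : U2) :
    (starRingEnd ℂ) (matU g 0 0) * matU g 0 0 + (starRingEnd ℂ) (matU g 1 0) * matU g 1 0 = 1 ∧
    (starRingEnd ℂ) (matU g 0 0) * matU g 0 1 + (starRingEnd ℂ) (matU g 1 0) * matU g 1 1 = 0 ∧
    (starRingEnd ℂ) (matU g 0 1) * matU g 0 0 + (starRingEnd ℂ) (matU g 1 1) * matU g 1 0 = 0 ∧
    (starRingEnd ℂ) (matU g 0 1) * matU g 0 1 + (starRingEnd ℂ) (matU g 1 1) * matU g 1 1 = 1 := by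
  have hg := Matrix.mem_unitaryGroup_iff'.1 g.2
  rw [Matrix.star_eq_conjTranspose] at hg
  have h00 := congrFun (congrFun hg 0) 0
  have h01 := congrFun (congrFun hg 0) 1
  have h10 := congrFun (congrFun hg 1) 0
  have h11 := congrFun (congrFun hg 1) 1
  simp [Matrix.mul_apply, Fin.sum_univ_two, Matrix.conjTranspose_apply] at h00 h01 h10 h11
  exact ⟨h00, h01, h10, h11⟩

/-- the columns of `h ∈ U(2)` as the second basis -/
def colBasis (h : U2) : Fin 2 → Fin 2 → ℂ := fun j i => matU h i j

/-- the columns of `h ∈ U(2)` are orthonormal for `h(·, ·)` -/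
theorem colBasis_disc (h : U2) :
    herm (starRingEnd ℂ) dd2 (colBasis h 0) (colBasis h 1) = 0 ∧
    disc' (starRingEnd ℂ) dd2 (colBasis h) 0 = 1 ∧ disc' (starRingEnd ℂ) dd2 (colBasis h) 1 = 1 := by
  obtain ⟨e00, e01, e10, e11⟩ := entries h
  unfold disc'
  rw [herm_eq, herm_eq, herm_eq]
  simp only [dd2, colBasis, Matrix.cons_val_zero, Matrix.cons_val_one]
  refine ⟨?_, ?_, ?_⟩
  · linear_combination e10
  · linear_combination e00
  · linear_combination e11

/-- **`κ(γ) = |(γ h)₀₀|²`** for the tori `K` and `h K h⁻¹` in `U(2)` -/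
theorem kappa_eq_normSq (γ h : U2) :
    kappa (starRingEnd ℂ) dd2 (colBasis h) (matU γ) = Complex.normSq (matU (γ * h) 0 0) := by
  have hd := (colBasis_disc h).2.1
  have hcol : (matU γ *ᵥ colBasis h 0) 0 = matU (γ * h) 0 0 := by
    simp [matU, colBasis, Matrix.mul_apply, Matrix.mulVec, dotProduct, Fin.sum_univ_two]
  unfold kappa
  rw [hd]
  simp only [dd2, Matrix.cons_val_zero, mul_one, div_one, nrm, cc, one_mul]
  rw [hcol, Complex.normSq_eq_conj_mul_self]
  ring

/-- the real relation `|a|² + |c|² = 1` for the first column of `g ∈ U(2)` -/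
theorem normSq_add_normSq (g : U2) :
    Complex.normSq (matU g 0 0) + Complex.normSq (matU g 1 0) = 1 := by
  obtain ⟨e00, -, -, -⟩ := entries g
  have e : (Complex.normSq (matU g 0 0) : ℂ) + (Complex.normSq (matU g 1 0) : ℂ) = 1 := by
    rw [Complex.normSq_eq_conj_mul_self, Complex.normSq_eq_conj_mul_self]
    exact e00
  exact_mod_cast e

/-- `κ(γ) ≤ 1` in `U(2)` -/
theorem kappa_le_one (γ h : U2) : (kappa (starRingEnd ℂ) dd2 (colBasis h) (matU γ)).re ≤ 1 := by
  rw [kappa_eq_normSq, Complex.ofReal_re]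
  have := normSq_add_normSq (γ * h)
  linarith [Complex.normSq_nonneg (matU (γ * h) 1 0)]

/-- **`κ(γ) = 1 ⟺ γ h ∈ K`** (the `(1,0)`-entry of `γ h` vanishes) -/
theorem kappa_eq_one_iff (γ h : U2) :
    kappa (starRingEnd ℂ) dd2 (colBasis h) (matU γ) = 1 ↔ matU (γ * h) 1 0 = 0 := by
  rw [kappa_eq_normSq, Complex.ofReal_eq_one]
  have := normSq_add_normSq (γ * h)
  constructor
  · intro h1
    apply Complex.normSq_eq_zero.1
    linarith
  · intro hc
    rw [hc, map_zero] at this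
    linarith

/-! ### The real rotations -/

/-- the rotation matrix `r(t) = [[cos t, sin t], [−sin t, cos t]]` -/
noncomputable def rotM (t : ℝ) : Matrix (Fin 2) (Fin 2) ℂ :=
  !![(Real.cos t : ℂ), (Real.sin t : ℂ); -(Real.sin t : ℂ), (Real.cos t : ℂ)]

/-- `r(t) ∈ U(2)` -/
theorem rotM_mem (t : ℝ) : rotM t ∈ Matrix.unitaryGroup (Fin 2) ℂ := by
  rw [Matrix.mem_unitaryGroup_iff', Matrix.star_eq_conjTranspose]
  ext i j
  fin_cases i <;> fin_cases j <;>
    simp [rotM, Matrix.mul_apply, Fin.sum_univ_two, Matrix.conjTranspose_apply, Complex.conj_ofReal,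
      -Complex.ofReal_cos, -Complex.ofReal_sin] <;>
    norm_cast <;> nlinarith [Real.cos_sq_add_sin_sq t]

/-- the rotation `r(t)` as an element of `U(2)` -/
noncomputable def rot (t : ℝ) : U2 := ⟨rotM t, rotM_mem t⟩

/-- `r(0) = 1` -/
theorem rot_zero : rot 0 = 1 := by
  apply Subtype.ext
  ext i j
  fin_cases i <;> fin_cases j <;> simp [rot, rotM]

/-- `t ↦ r(t)` is continuous -/
theorem continuous_rot : Continuous rot := by
  refine Continuous.subtype_mk ?_ _
  refine continuous_pi fun i => continuous_pi fun j => ?_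
  fin_cases i <;> fin_cases j <;> simp [rotM] <;> fun_prop

/-- `(r(t))₀₀ = cos t` -/
theorem matU_rot_zero_zero (t : ℝ) : matU (rot t) 0 0 = (Real.cos t : ℂ) := by
  simp [rot, rotM, matU]

/-- **`κ(r(t) h⁻¹) = cos² t`** -/
theorem kappa_rot_mul_inv (t : ℝ) (h : U2) :
    kappa (starRingEnd ℂ) dd2 (colBasis h) (matU (rot t * h⁻¹)) = ((Real.cos t ^ 2 : ℝ) : ℂ) := by
  rw [kappa_eq_normSq, inv_mul_cancel_right, matU_rot_zero_zero, Complex.normSq_ofReal, sq]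

/-- **`r(t) h⁻¹` is regular for `0 < t < π`**: `κ(r(t) h⁻¹) ≠ 1` -/
theorem kappa_rot_mul_inv_ne_one {t : ℝ} (ht0 : 0 < t) (htπ : t < Real.pi) (h : U2) :
    kappa (starRingEnd ℂ) dd2 (colBasis h) (matU (rot t * h⁻¹)) ≠ 1 := by
  rw [kappa_rot_mul_inv, Ne, Complex.ofReal_eq_one]
  have hs : 0 < Real.sin t := Real.sin_pos_of_pos_of_lt_pi ht0 htπ
  have := Real.cos_sq_add_sin_sq t
  nlinarith

/-! ### The regular point with non-vanishing coefficient -/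

variable {V : Type*} [NormedAddCommGroup V] [InnerProductSpace ℂ V]

/-- **a regular `γ₀` with `⟪x, τ(γ₀ h) x⟫ ≠ 0`** for any strongly continuous `τ` and `x ≠ 0` -/
theorem exists_regular_coeff_ne_zero (τ : U2 →* (V →ₗ[ℂ] V)) (hc : IsStronglyContinuous τ) (x : V)
    (hx : x ≠ 0) (h : U2) :
    ∃ γ₀ : U2, kappa (starRingEnd ℂ) dd2 (colBasis h) (matU γ₀) ≠ 1 ∧ coeff τ x x (γ₀ * h) ≠ 0 := by
  -- the coefficient along the rotations is continuous with value `⟪x, x⟫ ≠ 0` at `t = 0`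
  have hcont : Continuous fun t : ℝ => coeff τ x x (rot t) := (continuous_coeff hc x x).comp continuous_rot
  have h0 : coeff τ x x (rot 0) ≠ 0 := by
    rw [rot_zero]
    unfold coeff
    rw [map_one, Module.End.one_apply]
    exact inner_self_ne_zero.2 hx
  have hev : ∀ᶠ t in 𝓝 (0 : ℝ), coeff τ x x (rot t) ≠ 0 := hcont.continuousAt.eventually_ne h0
  -- pick `t ∈ (0, π)` in that neighbourhood
  have hev' : ∀ᶠ t in 𝓝[>] (0 : ℝ), coeff τ x x (rot t) ≠ 0 ∧ t ∈ Set.Ioo (0 : ℝ) Real.pi :=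
    (hev.filter_mono nhdsWithin_le_nhds).and (Ioo_mem_nhdsGT Real.pi_pos)
  obtain ⟨t, ht, ht0, htπ⟩ := hev'.exists
  refine ⟨rot t * h⁻¹, kappa_rot_mul_inv_ne_one ht0 htπ h, ?_⟩
  rwa [inv_mul_cancel_right]

variable [MeasurableSpace Circle] [BorelSpace Circle]

/-- **a regular `γ₀` with non-zero two-torus orbital integral** (`x` a weight vector of both tori, matching
characters `p = −a`, `q = b`), in `U(2)` -/
theorem exists_regular_torusOrbital_ne_zero {τ : U2 →* (V →ₗ[ℂ] V)} (hτ : IsUnitaryRep τ)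
    (hc : IsStronglyContinuous τ) {ρA ρB : Circle →* U2} {a b : ℤ} {x : V} (hA : IsWeightVector τ ρA a x)
    (hB : IsWeightVector τ ρB b x) (hx : x ≠ 0) (h : U2) :
    ∃ γ₀ : U2, kappa (starRingEnd ℂ) dd2 (colBasis h) (matU γ₀) ≠ 1 ∧
      ∫ u : Circle, ∫ v : Circle,
        coeff τ (τ h x) x (ρA u * γ₀ * (h * ρB v * h⁻¹)) * ((u : ℂ) ^ (-a) * (starRingEnd ℂ) ((v : ℂ) ^ b))
        ∂T5HaarCircle.haarCircle ∂T5HaarCircle.haarCircle ≠ 0 := by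
  obtain ⟨γ₀, hκ, hco⟩ := exists_regular_coeff_ne_zero τ hc x hx h
  refine ⟨γ₀, hκ, ?_⟩
  rw [torus_orbital_conj_eq hτ hA hB h γ₀ (-a) b, if_pos (by ring), if_pos rfl, one_mul, one_mul]
  exact hco

end Summit.Ventures.HodgeRepro2.T7SupportCompactRegularPoint
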